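import Summits.AtomisticToContinuum.HydrodynamicLimit.Theorems.LambertianContactSwapLambertianEulerKorolyuk
import Summits.AtomisticToContinuum.HydrodynamicLimit.Theorems.LambertianContactSwapLambertianEulerFirstCollision
import HarnessLib

/-!
# Tools for the equilibrium concentration of the Lambertian window collision count
# (`LambertianContactSwap.LambertianEuler`, stmt-AtomisticToContinuum-11854, line `Sketch`; lead c10,
# final assembly, part 1: registered stub `markInd_freeFlight_le`)

Support file (`--supports stmt-AtomisticToContinuum-11854`).  Small deterministic / measure-free tools
of lead c10's theorem `windowCountOverflow_equilibrium_le` (upper-tail concentration of the window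
collision count of the Lambertian hard-sphere gas at global equilibrium):

* `lambertCount_mono_of_acc` — on a non-accumulating path the collision count is monotone in time;
* the MARK of a pair `q` at a configuration `y` with shell width `wd`, cell width `δ`: the indicator of
  "some third particle `r ∉ {q.1, q.2}` lies in the velocity shell `ε ≤ d ≤ ε + wd ‖Δv‖` of `q.1` or of
  `q.2`, or the pair is fast, `1/2 ≤ δ ‖v_{q.1} − v_{q.2}‖`"; `measurable_markInd` (measurability in `y`)
  and the TRANSPORT inequality `markInd_freeFlight_le`: for `y` in the hard-sphere domain and
  `0 ≤ u ≤ δ`, the mark of width `δ` read after the free flight `S_u` is at most the mark of width `2δ`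
  read on `y` (velocities are unchanged; the minimal-image distance is `1`-Lipschitz along translations,
  `…FirstCollision.norm_sepVec_le_norm_sepVec_freeFlight_add`, and `≥ ε` in the domain).

All statements [folklore].
-/

noncomputable section

namespace Summit.AtomisticToContinuum.HydrodynamicLimit.Theorems.LambertianContactSwapLambertianEulerWindowCountTools

open scoped BigOperators Topology ENNReal InnerProductSpace
open MeasureTheory ProbabilityTheory Filter Set
open Literature.MathematicalPhysics.KineticTheory
open Literature.Analysis.FluidPDE Literature.Analysis.FluidPDE.Alexander
open Summit.AtomisticToContinuum.HydrodynamicLimit.Theorems.LambertianContactSwapLambertianEulerKorolyuk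

/-! ## Monotonicity of the count -/

/-- **The Lambertian collision count is monotone in time on a non-accumulating path**: if the instants
pass beyond every horizon then `K_s ≤ K_t` for `s ≤ t` (the count is the index of the segment of `s`,
and `t_{K_s} ≤ s ≤ t`). [folklore] -/
theorem lambertCount_mono_of_acc {d : Type*} [Fintype d] {X : Type*} {N : ℕ} {G : Geometry d X} {ε : ℝ}
    {ξs : ℕ → EuclideanSpace ℝ d} {z : Config N d X}
    (hacc : ∀ T : ℝ, ∃ k, ENNReal.ofReal T < lambertInstant G ε ξs z k) {s t : ℝ} (hst : s ≤ t) :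
    lambertCount G ε ξs z s ≤ lambertCount G ε ξs z t := by
  obtain ⟨m, hm1, hm2⟩ := LRestart.exists_lambert_segment (hacc s) le_rfl
  rw [lambertCount_eq_of_segment hm1 hm2]
  exact le_lambertCount_of_lambertInstant_le (hacc t) (hm1.trans (ENNReal.ofReal_le_ofReal hst))

/-! ## The mark: measurability and transport along free flight -/

/-- **The mark event is measurable**: for fixed `q`, widths `wd`, `δ` and diameter `ε`, the set of
configurations in which some `r ∉ {q.1, q.2}` lies in the `wd`-velocity shell of `q.1` or of `q.2`, or
`1/2 ≤ δ ‖v_{q.1} − v_{q.2}‖`, is measurable (finite unions and intersections of closed conditions on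
continuous coordinates). [folklore] -/
theorem measurableSet_mark (N : ℕ) (ε wd δ : ℝ) (q : Fin (N + 1) × Fin (N + 1)) :
    MeasurableSet {y : Config (N + 1) (Fin 3) T3 |
      (∃ r : Fin (N + 1), r ≠ q.1 ∧ r ≠ q.2 ∧
        ((ε ≤ ‖(Torus.geometry (Fin 3)).sepVec (y q.1).1 (y r).1‖ ∧
            ‖(Torus.geometry (Fin 3)).sepVec (y q.1).1 (y r).1‖ ≤ ε + wd * ‖(y q.1).2 - (y r).2‖) ∨
          (ε ≤ ‖(Torus.geometry (Fin 3)).sepVec (y q.2).1 (y r).1‖ ∧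
            ‖(Torus.geometry (Fin 3)).sepVec (y q.2).1 (y r).1‖ ≤ ε + wd * ‖(y q.2).2 - (y r).2‖))) ∨
        2⁻¹ ≤ δ * ‖(y q.1).2 - (y q.2).2‖} := by
  have hsh : ∀ (i j : Fin (N + 1)), MeasurableSet {y : Config (N + 1) (Fin 3) T3 |
      ε ≤ ‖(Torus.geometry (Fin 3)).sepVec (y i).1 (y j).1‖ ∧
        ‖(Torus.geometry (Fin 3)).sepVec (y i).1 (y j).1‖ ≤ ε + wd * ‖(y i).2 - (y j).2‖} := by
    intro i j
    have hd : Measurable fun y : Config (N + 1) (Fin 3) T3 => ‖(Torus.geometry (Fin 3)).sepVec (y i).1 (y j).1‖ :=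
      (Torus.measurable_geometry_sepVec.comp
        ((measurable_pi_apply i).fst.prodMk (measurable_pi_apply j).fst)).norm
    have hr : Measurable fun y : Config (N + 1) (Fin 3) T3 => ε + wd * ‖(y i).2 - (y j).2‖ :=
      measurable_const.add (((measurable_pi_apply i).snd.sub (measurable_pi_apply j).snd).norm.const_mul wd)
    exact (measurableSet_le measurable_const hd).inter (measurableSet_le hd hr)
  have hfast : MeasurableSet {y : Config (N + 1) (Fin 3) T3 | 2⁻¹ ≤ δ * ‖(y q.1).2 - (y q.2).2‖} :=
    measurableSet_le measurable_const
      (((measurable_pi_apply q.1).snd.sub (measurable_pi_apply q.2).snd).norm.const_mul δ)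
  have heq : {y : Config (N + 1) (Fin 3) T3 |
      (∃ r : Fin (N + 1), r ≠ q.1 ∧ r ≠ q.2 ∧
        ((ε ≤ ‖(Torus.geometry (Fin 3)).sepVec (y q.1).1 (y r).1‖ ∧
            ‖(Torus.geometry (Fin 3)).sepVec (y q.1).1 (y r).1‖ ≤ ε + wd * ‖(y q.1).2 - (y r).2‖) ∨
          (ε ≤ ‖(Torus.geometry (Fin 3)).sepVec (y q.2).1 (y r).1‖ ∧
            ‖(Torus.geometry (Fin 3)).sepVec (y q.2).1 (y r).1‖ ≤ ε + wd * ‖(y q.2).2 - (y r).2‖))) ∨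
        2⁻¹ ≤ δ * ‖(y q.1).2 - (y q.2).2‖} =
      (⋃ r : Fin (N + 1), {_y : Config (N + 1) (Fin 3) T3 | r ≠ q.1 ∧ r ≠ q.2} ∩
        ({y | ε ≤ ‖(Torus.geometry (Fin 3)).sepVec (y q.1).1 (y r).1‖ ∧
            ‖(Torus.geometry (Fin 3)).sepVec (y q.1).1 (y r).1‖ ≤ ε + wd * ‖(y q.1).2 - (y r).2‖} ∪
          {y | ε ≤ ‖(Torus.geometry (Fin 3)).sepVec (y q.2).1 (y r).1‖ ∧
            ‖(Torus.geometry (Fin 3)).sepVec (y q.2).1 (y r).1‖ ≤ ε + wd * ‖(y q.2).2 - (y r).2‖})) ∪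
        {y | 2⁻¹ ≤ δ * ‖(y q.1).2 - (y q.2).2‖} := by
    ext y
    simp only [Set.mem_setOf_eq, Set.mem_union, Set.mem_iUnion, Set.mem_inter_iff, and_assoc]
  rw [heq]
  exact (MeasurableSet.iUnion fun r => (MeasurableSet.const _).inter ((hsh q.1 r).union (hsh q.2 r))).union
    hfast

/-- **The mark indicator is measurable** in the configuration. [folklore] -/
theorem measurable_markInd (N : ℕ) (ε wd δ : ℝ) (q : Fin (N + 1) × Fin (N + 1)) :
    Measurable fun y : Config (N + 1) (Fin 3) T3 =>
      if (∃ r : Fin (N + 1), r ≠ q.1 ∧ r ≠ q.2 ∧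
          ((ε ≤ ‖(Torus.geometry (Fin 3)).sepVec (y q.1).1 (y r).1‖ ∧
              ‖(Torus.geometry (Fin 3)).sepVec (y q.1).1 (y r).1‖ ≤ ε + wd * ‖(y q.1).2 - (y r).2‖) ∨
            (ε ≤ ‖(Torus.geometry (Fin 3)).sepVec (y q.2).1 (y r).1‖ ∧
              ‖(Torus.geometry (Fin 3)).sepVec (y q.2).1 (y r).1‖ ≤ ε + wd * ‖(y q.2).2 - (y r).2‖))) ∨
          2⁻¹ ≤ δ * ‖(y q.1).2 - (y q.2).2‖ then (1 : ℝ) else 0 :=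
  Measurable.ite (measurableSet_mark N ε wd δ q) measurable_const measurable_const

/-- **One shell transported back along free flight.**  On the flat torus, if `y` lies in the hard-sphere
domain of diameter `ε`, `a ≠ r`, `0 ≤ u ≤ δ`, and after the free flight `S_u` the pair `(a, r)` is in
the `δ`-velocity shell, then in `y` it is in the `2δ`-velocity shell. [folklore] -/
theorem shell_of_shell_freeFlight {N : ℕ} {ε δ u : ℝ} {y : Config (N + 1) (Fin 3) T3}
    (hy : y ∈ hardSphereDomain (Torus.geometry (Fin 3)) (N + 1) ε) {a r : Fin (N + 1)} (har : a ≠ r)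
    (hu0 : 0 ≤ u) (huδ : u ≤ δ)
    (h : ε ≤ ‖(Torus.geometry (Fin 3)).sepVec ((freeFlight (Torus.geometry (Fin 3)) u y) a).1
          ((freeFlight (Torus.geometry (Fin 3)) u y) r).1‖ ∧
        ‖(Torus.geometry (Fin 3)).sepVec ((freeFlight (Torus.geometry (Fin 3)) u y) a).1
          ((freeFlight (Torus.geometry (Fin 3)) u y) r).1‖ ≤
          ε + δ * ‖((freeFlight (Torus.geometry (Fin 3)) u y) a).2 - ((freeFlight (Torus.geometry (Fin 3)) u y) r).2‖) :
    ε ≤ ‖(Torus.geometry (Fin 3)).sepVec (y a).1 (y r).1‖ ∧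
      ‖(Torus.geometry (Fin 3)).sepVec (y a).1 (y r).1‖ ≤ ε + (2 * δ) * ‖(y a).2 - (y r).2‖ := by
  refine ⟨hy a r har, ?_⟩
  have hL := LambertianContactSwapLambertianEulerFirstCollision.norm_sepVec_le_norm_sepVec_freeFlight_add y u a r
  have hv : ‖((freeFlight (Torus.geometry (Fin 3)) u y) a).2 - ((freeFlight (Torus.geometry (Fin 3)) u y) r).2‖ =
      ‖(y a).2 - (y r).2‖ := by simp only [freeFlight_apply]
  rw [hv] at h
  rw [abs_of_nonneg hu0] at hL
  have hg : 0 ≤ ‖(y a).2 - (y r).2‖ := norm_nonneg _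
  nlinarith [h.2, hL, mul_le_mul_of_nonneg_right huδ hg]

/-- **Transport of the mark along free flight** (registered stub `markInd_freeFlight_le` of lead c10,
final assembly part 1).  For `y` in the hard-sphere domain of diameter `ε` on `𝕋³` and `0 ≤ u ≤ δ`, the
mark of width `δ` (cell width `δ`) of any pair `q` read on `S_u y` is at most the mark of width `2δ`
read on `y`: velocities are unchanged by the free flight and each `δ`-shell after the flight is a
`2δ`-shell before it (`shell_of_shell_freeFlight`). [folklore] -/
theorem markInd_freeFlight_le :
    ∀ (N : ℕ) (ε δ : ℝ) (q : Fin (N + 1) × Fin (N + 1)) (y : Config (N + 1) (Fin 3) T3) (u : ℝ),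
      y ∈ hardSphereDomain (Torus.geometry (Fin 3)) (N + 1) ε → 0 ≤ u → u ≤ δ →
      (if (∃ r : Fin (N + 1), r ≠ q.1 ∧ r ≠ q.2 ∧
            ((ε ≤ ‖(Torus.geometry (Fin 3)).sepVec ((freeFlight (Torus.geometry (Fin 3)) u y) q.1).1
                  ((freeFlight (Torus.geometry (Fin 3)) u y) r).1‖ ∧
                ‖(Torus.geometry (Fin 3)).sepVec ((freeFlight (Torus.geometry (Fin 3)) u y) q.1).1
                  ((freeFlight (Torus.geometry (Fin 3)) u y) r).1‖ ≤
                  ε + δ * ‖((freeFlight (Torus.geometry (Fin 3)) u y) q.1).2 -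
                    ((freeFlight (Torus.geometry (Fin 3)) u y) r).2‖) ∨
              (ε ≤ ‖(Torus.geometry (Fin 3)).sepVec ((freeFlight (Torus.geometry (Fin 3)) u y) q.2).1
                  ((freeFlight (Torus.geometry (Fin 3)) u y) r).1‖ ∧
                ‖(Torus.geometry (Fin 3)).sepVec ((freeFlight (Torus.geometry (Fin 3)) u y) q.2).1
                  ((freeFlight (Torus.geometry (Fin 3)) u y) r).1‖ ≤
                  ε + δ * ‖((freeFlight (Torus.geometry (Fin 3)) u y) q.2).2 -
                    ((freeFlight (Torus.geometry (Fin 3)) u y) r).2‖))) ∨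
            2⁻¹ ≤ δ * ‖((freeFlight (Torus.geometry (Fin 3)) u y) q.1).2 -
              ((freeFlight (Torus.geometry (Fin 3)) u y) q.2).2‖ then (1 : ℝ) else 0) ≤
        (if (∃ r : Fin (N + 1), r ≠ q.1 ∧ r ≠ q.2 ∧
              ((ε ≤ ‖(Torus.geometry (Fin 3)).sepVec (y q.1).1 (y r).1‖ ∧
                  ‖(Torus.geometry (Fin 3)).sepVec (y q.1).1 (y r).1‖ ≤ ε + (2 * δ) * ‖(y q.1).2 - (y r).2‖) ∨
                (ε ≤ ‖(Torus.geometry (Fin 3)).sepVec (y q.2).1 (y r).1‖ ∧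
                  ‖(Torus.geometry (Fin 3)).sepVec (y q.2).1 (y r).1‖ ≤ ε + (2 * δ) * ‖(y q.2).2 - (y r).2‖))) ∨
              2⁻¹ ≤ δ * ‖(y q.1).2 - (y q.2).2‖ then (1 : ℝ) else 0) := by
  intro N ε δ q y u hy hu0 huδ
  split_ifs with h1 h2
  · exact le_rfl
  · exfalso
    refine h2 ?_
    rcases h1 with ⟨r, hr1, hr2, hsh | hsh⟩ | hfast
    · exact Or.inl ⟨r, hr1, hr2, Or.inl (shell_of_shell_freeFlight hy (Ne.symm hr1) hu0 huδ hsh)⟩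
    · exact Or.inl ⟨r, hr1, hr2, Or.inr (shell_of_shell_freeFlight hy (Ne.symm hr2) hu0 huδ hsh)⟩
    · refine Or.inr ?_
      simpa only [freeFlight_apply] using hfast
  · exact zero_le_one
  · exact le_rfl

end Summit.AtomisticToContinuum.HydrodynamicLimit.Theorems.LambertianContactSwapLambertianEulerWindowCountTools

end
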